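import Literature.Analysis.FunctionSpaces.SchauderConstantLaplacianReal
import Literature.Analysis.FunctionSpaces.SchauderEllipticReduction
import HarnessLib

/-!
# The Schauder estimate for constant elliptic coefficients on `ℝⁿ` (Schauder program, B2)

Topic `Literature/Analysis/FunctionSpaces`. For an orthonormal basis `e` of the finite-dimensional
real inner product space `E`, `0 < α < 1` and ellipticity bounds `0 < λ ≤ Λ`, there is ONE constant
`C < ∞` such that for every symmetric matrix `A` with `λ|ξ|² ≤ Aᵢⱼξᵢξⱼ ≤ Λ|ξ|²` and every real
`u ∈ C²_b(E)` whose "frozen operator" `L_A u = ∑ᵢⱼ Aᵢⱼ D²u(eᵢ, eⱼ)` is `α`-Hölder with constant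
`C_L`,

  `‖D²u(x)(e_p, e_q) − D²u(y)(e_p, e_q)‖ ≤ C (‖u‖_∞ + C_L) ‖x − y‖^α`

(Gilbarg–Trudinger 2001, Lemma 6.1): with the automorphism `S` of
`exists_equiv_sum_inner_mul_inner_eq` (`∑ₖ ⟪S eₖ, eᵢ⟫⟪S eₖ, eⱼ⟫ = Aᵢⱼ`, `‖S‖ ≤ √Λ`, `‖S⁻¹‖ ≤ 1/√λ`)
one has `Δ(u ∘ S) = (L_A u) ∘ S`, so the constant-coefficient estimate for `Δ`
(`exists_schauder_const_laplacian_direction_real`) applies to `u ∘ S`, and `D²u` is recovered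
from `D²(u ∘ S)` bilinearly with coefficients bounded by `‖S⁻¹‖²`.

* `exists_schauder_const_coeff` — the statement above (uniform in `A`).

Census item (2a) of `Literature.Geometry.Riemannian.gurskyViaclovsky_pathOpen_weighted_four`.
Everything is proved; no named facts.

## References

* D. Gilbarg, N. S. Trudinger, *Elliptic Partial Differential Equations of Second Order* (2001),
  Lemma 6.1. [GilbargTrudinger2001]
-/

noncomputable section

open MeasureTheory Filter Topology Function
open scoped ENNReal NNReal ContDiff Laplacian InnerProductSpace RealInnerProductSpace

namespace Literature.Analysis.FunctionSpaces

variable {ι : Type*} [Fintype ι] [DecidableEq ι] {E : Type*} [NormedAddCommGroup E]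
  [InnerProductSpace ℝ E] {F : Type*} [NormedAddCommGroup F] [NormedSpace ℝ F]

/-! ### Bilinear bookkeeping for second derivatives -/

omit [DecidableEq ι] in
/-- Bilinear expansion in an orthonormal basis: `B v w = ∑ᵢⱼ ⟪eᵢ, v⟫ ⟪eⱼ, w⟫ B eᵢ eⱼ`. [folklore] -/
theorem clm_clm_apply_eq_sum_orthonormalBasis (bE : OrthonormalBasis ι ℝ E) (B : E →L[ℝ] E →L[ℝ] F)
    (v w : E) : B v w = ∑ i, ∑ j, (⟪bE i, v⟫ * ⟪bE j, w⟫) • B (bE i) (bE j) := by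
  conv_lhs => rw [← bE.sum_repr' v, ← bE.sum_repr' w]
  simp only [map_sum, map_smul, _root_.sum_apply, _root_.smul_apply, Finset.smul_sum, smul_smul,
    mul_comm (⟪bE _, w⟫)]
  exact Finset.sum_comm

omit [InnerProductSpace ℝ E] in
/-- `D²u(x)(v, w) = (D(Du)(x) v) w`. [folklore] -/
theorem iteratedFDeriv_two_vecCons [NormedSpace ℝ E] (u : E → F) (x v w : E) :
    iteratedFDeriv ℝ 2 u x ![v, w] = fderiv ℝ (fderiv ℝ u) x v w := by
  rw [iteratedFDeriv_two_apply]
  rfl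

omit [DecidableEq ι] in
/-- Bilinear expansion of second derivatives in an orthonormal basis. [folklore] -/
theorem iteratedFDeriv_two_eq_sum_orthonormalBasis (bE : OrthonormalBasis ι ℝ E) (u : E → F)
    (x v w : E) : iteratedFDeriv ℝ 2 u x ![v, w] =
      ∑ i, ∑ j, (⟪bE i, v⟫ * ⟪bE j, w⟫) • iteratedFDeriv ℝ 2 u x ![bE i, bE j] := by
  simp only [iteratedFDeriv_two_vecCons]
  exact clm_clm_apply_eq_sum_orthonormalBasis bE _ v w

omit [InnerProductSpace ℝ E] in
/-- Composing a pair of vectors with a map. [folklore] -/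
theorem comp_vecCons_two [NormedSpace ℝ E] (g : E → E) (v w : E) :
    (fun i : Fin 2 => g (![v, w] i)) = ![g v, g w] := by
  funext i
  fin_cases i <;> rfl

omit [InnerProductSpace ℝ E] in
/-- Second derivatives of `u ∘ S` for a continuous linear `S`:
`D²(u ∘ S)(y)(v, w) = D²u(Sy)(Sv, Sw)`. [folklore] -/
theorem iteratedFDeriv_two_comp_clm [NormedSpace ℝ E] {u : E → F} (hu : ContDiff ℝ 2 u)
    (S : E →L[ℝ] E) (y v w : E) :
    iteratedFDeriv ℝ 2 (u ∘ S) y ![v, w] = iteratedFDeriv ℝ 2 u (S y) ![S v, S w] := by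
  rw [S.iteratedFDeriv_comp_right hu y le_rfl, ContinuousMultilinearMap.compContinuousLinearMap_apply,
    comp_vecCons_two]

/-- `edist` of two linear combinations with the same real coefficients. [folklore] -/
theorem edist_sum_sum_smul_le {κ : Type*} (s : Finset κ) (c : κ → ℝ) (f g : κ → F) :
    edist (∑ k ∈ s, c k • f k) (∑ k ∈ s, c k • g k) ≤ ∑ k ∈ s, ‖c k‖ₑ * edist (f k) (g k) := by
  rw [edist_eq_enorm_sub, ← Finset.sum_sub_distrib]
  refine (enorm_sum_le s _).trans (Finset.sum_le_sum fun k _ => ?_)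
  rw [← smul_sub, enorm_smul, edist_eq_enorm_sub]

/-! ### The estimate -/

variable [FiniteDimensional ℝ E] [MeasurableSpace E] [BorelSpace E]

/-- **The Schauder estimate for constant elliptic coefficients, uniform in the ellipticity
class.** For an orthonormal basis `e` of `E`, `0 < α < 1` and `0 < λ`, `Λ`, there is `C < ∞` such
that for every symmetric `A` with `λ ∑ ξᵢ² ≤ ∑ Aᵢⱼ ξᵢ ξⱼ ≤ Λ ∑ ξᵢ²`, every real `u ∈ C²_b(E)`
(bounded with bounded first and second derivatives) with `x ↦ ∑ᵢⱼ Aᵢⱼ D²u(x)(eᵢ, eⱼ)` `α`-Hölder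
with constant `C_L`, and all `p q`:
`edist (D²u(x)(e_p, e_q)) (D²u(y)(e_p, e_q)) ≤ C (‖u‖_∞ + C_L) edist(x, y)^α`.
[cite: GilbargTrudinger2001, Lemma 6.1] -/
theorem exists_schauder_const_coeff (bE : OrthonormalBasis ι ℝ E) {α : ℝ≥0} (hα0 : 0 < α)
    (hα1 : α < 1) {l L : ℝ} (hl : 0 < l) :
    ∃ C : ℝ≥0∞, C < ⊤ ∧ ∀ (A : Matrix ι ι ℝ), (∀ i j, A i j = A j i) →
      (∀ ξ : ι → ℝ, l * ∑ i, ξ i ^ 2 ≤ ∑ i, ∑ j, A i j * ξ i * ξ j) →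
      (∀ ξ : ι → ℝ, ∑ i, ∑ j, A i j * ξ i * ξ j ≤ L * ∑ i, ξ i ^ 2) →
      ∀ (u : E → ℝ) (M₀ M₁ M₂ : ℝ) (CL : ℝ≥0), ContDiff ℝ 2 u → (∀ x, ‖u x‖ ≤ M₀) →
        (∀ x, ‖fderiv ℝ u x‖ ≤ M₁) → (∀ x, ‖iteratedFDeriv ℝ 2 u x‖ ≤ M₂) →
        HolderWith CL α (fun x => ∑ i, ∑ j, A i j * iteratedFDeriv ℝ 2 u x ![bE i, bE j]) →
        ∀ (p q : ι) (x y : E),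
          edist (iteratedFDeriv ℝ 2 u x ![bE p, bE q]) (iteratedFDeriv ℝ 2 u y ![bE p, bE q]) ≤
            C * (ENNReal.ofReal M₀ + CL) * edist x y ^ (α : ℝ) := by
  have hα0' : (0 : ℝ) ≤ α := hα0.le
  -- the constants of the Laplacian estimate in the basis directions
  choose Cpq hCpqtop hCpq using
    fun p q => exists_schauder_const_laplacian_direction_real (E := E) hα0 hα1 (bE p) (bE q)
  set Csum : ℝ≥0∞ := ∑ i, ∑ j, Cpq i j with hCsum
  have hCsumtop : Csum < ⊤ :=
    ENNReal.sum_lt_top.2 fun i _ => ENNReal.sum_lt_top.2 fun j _ => hCpqtop i j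
  -- the bounds on `‖S‖^α`, `‖S⁻¹‖`
  set sL : ℝ≥0 := (Real.sqrt L).toNNReal ^ (α : ℝ) with hsL
  set KL : ℝ≥0∞ := 1 + (sL : ℝ≥0∞) with hKL
  set KI : ℝ≥0∞ := ENNReal.ofReal (Real.sqrt l)⁻¹ with hKI
  have hKLtop : KL < ⊤ := ENNReal.add_lt_top.2 ⟨ENNReal.one_lt_top, ENNReal.coe_lt_top⟩
  have hKItop : KI < ⊤ := ENNReal.ofReal_lt_top
  set C : ℝ≥0∞ := Csum * KL * (KI * KI) * KI ^ (α : ℝ) with hC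
  have hCtop : C < ⊤ :=
    ENNReal.mul_lt_top (ENNReal.mul_lt_top (ENNReal.mul_lt_top hCsumtop hKLtop)
      (ENNReal.mul_lt_top hKItop hKItop)) (ENNReal.rpow_lt_top_of_nonneg hα0' hKItop.ne)
  refine ⟨C, hCtop, fun A hsymm hlow hup u M₀ M₁ M₂ CL hu hM₀ hM₁ hM₂ hH p q x y => ?_⟩
  -- Step 1: the change of variables `S`
  obtain ⟨S, hSA, hSn, hSin⟩ := exists_equiv_sum_inner_mul_inner_eq bE A hsymm hl hlow hup
  set S' : E →L[ℝ] E := (S : E →L[ℝ] E) with hS'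
  have hS'ap : ∀ v, S' v = S v := fun v => rfl
  set v : E → ℝ := u ∘ S' with hv
  have hvc : ContDiff ℝ 2 v := hu.comp S'.contDiff
  have hD2v : ∀ z a b, iteratedFDeriv ℝ 2 v z ![a, b] = iteratedFDeriv ℝ 2 u (S' z) ![S' a, S' b] :=
    fun z a b => iteratedFDeriv_two_comp_clm hu S' z a b
  -- Step 2: the `C²_b` bounds of `v`
  have hv0 : ∀ z, ‖v z‖ ≤ M₀ := fun z => hM₀ _
  have hv1 : ∀ z, ‖fderiv ℝ v z‖ ≤ M₁ * ‖S'‖ := fun z => by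
    have hd : DifferentiableAt ℝ u (S' z) := (hu.differentiable (by norm_num)) _
    rw [hv, fderiv_comp z hd S'.differentiableAt, S'.fderiv]
    exact (ContinuousLinearMap.opNorm_comp_le _ _).trans
      (mul_le_mul_of_nonneg_right (hM₁ _) (norm_nonneg _))
  have hv2 : ∀ z, ‖iteratedFDeriv ℝ 2 v z‖ ≤ M₂ * ‖S'‖ ^ 2 := fun z => by
    rw [hv, S'.iteratedFDeriv_comp_right hu z le_rfl]
    refine (ContinuousMultilinearMap.norm_compContinuousLinearMap_le _ _).trans ?_
    rw [Finset.prod_const, Finset.card_univ, Fintype.card_fin]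
    exact mul_le_mul_of_nonneg_right (hM₂ _) (by positivity)
  -- Step 3: `Δ v = (L_A u) ∘ S`
  have hent : ∀ k i, ⟪bE i, S' (bE k)⟫ = ⟪S (bE k), bE i⟫ := fun k i => by
    rw [hS'ap, real_inner_comm]
  have hΔv : Δ v = (fun x => ∑ i, ∑ j, A i j * iteratedFDeriv ℝ 2 u x ![bE i, bE j]) ∘ S' := by
    funext z
    rw [InnerProductSpace.laplacian_eq_iteratedFDeriv_orthonormalBasis v bE]
    simp only [Function.comp_apply, hD2v]
    simp only [iteratedFDeriv_two_eq_sum_orthonormalBasis bE u (S' z) (S' _) (S' _), smul_eq_mul]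
    rw [Finset.sum_comm]
    refine Finset.sum_congr rfl fun i _ => ?_
    rw [Finset.sum_comm]
    refine Finset.sum_congr rfl fun j _ => ?_
    rw [← Finset.sum_mul, ← hSA i j]
    simp only [hent]
  have hΔH : HolderWith (CL * ‖S'‖₊ ^ (α : ℝ)) α (Δ v) := by
    have h := hH.comp S'.lipschitz.holderWith
    rw [mul_one] at h
    rwa [hΔv]
  -- Step 4: the Laplacian estimate for `v` in the basis directions
  have hmain : ∀ (i j : ι) (z₁ z₂ : E),
      edist (iteratedFDeriv ℝ 2 v z₁ ![bE i, bE j]) (iteratedFDeriv ℝ 2 v z₂ ![bE i, bE j]) ≤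
        Cpq i j * (ENNReal.ofReal M₀ + (CL * ‖S'‖₊ ^ (α : ℝ) : ℝ≥0)) * edist z₁ z₂ ^ (α : ℝ) :=
    fun i j z₁ z₂ => hCpq i j v M₀ _ _ _ hvc hv0 hv1 hv2 hΔH z₁ z₂
  -- Step 5: `D²u(x)(e_p, e_q)` from `D²v`
  set z₁ := S.symm x with hz₁
  set z₂ := S.symm y with hz₂
  set c : ι × ι → ℝ := fun ij => ⟪bE ij.1, S.symm (bE p)⟫ * ⟪bE ij.2, S.symm (bE q)⟫ with hc
  have hexp : ∀ (w : E), iteratedFDeriv ℝ 2 u w ![bE p, bE q] =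
      ∑ ij ∈ (Finset.univ : Finset (ι × ι)),
        c ij • iteratedFDeriv ℝ 2 v (S.symm w) ![bE ij.1, bE ij.2] := by
    intro w
    have h1 : iteratedFDeriv ℝ 2 u w ![bE p, bE q] =
        iteratedFDeriv ℝ 2 v (S.symm w) ![S.symm (bE p), S.symm (bE q)] := by
      rw [hD2v]
      simp only [hS'ap, ContinuousLinearEquiv.apply_symm_apply]
    rw [h1, iteratedFDeriv_two_eq_sum_orthonormalBasis bE v, ← Finset.univ_product_univ,
      Finset.sum_product]
  -- Step 6: the estimate
  have hcoef : ∀ ij : ι × ι, ‖c ij‖ₑ ≤ KI * KI := by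
    intro ij
    have hb : ∀ (i : ι) (w : E), |⟪bE i, S.symm w⟫| ≤ (Real.sqrt l)⁻¹ * ‖w‖ := fun i w => by
      refine (abs_real_inner_le_norm _ _).trans ?_
      rw [bE.norm_eq_one i, one_mul]
      exact ((S.symm : E →L[ℝ] E).le_opNorm w).trans (mul_le_mul_of_nonneg_right hSin (norm_nonneg _))
    rw [← ofReal_norm, hKI, ← ENNReal.ofReal_mul (inv_nonneg.2 (Real.sqrt_nonneg _))]
    refine ENNReal.ofReal_le_ofReal ?_
    rw [hc, Real.norm_eq_abs, abs_mul]
    have h1 := hb ij.1 (bE p)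
    have h2 := hb ij.2 (bE q)
    rw [bE.norm_eq_one, mul_one] at h1 h2
    exact mul_le_mul h1 h2 (abs_nonneg _) (inv_nonneg.2 (Real.sqrt_nonneg _))
  have hz : edist z₁ z₂ ^ (α : ℝ) ≤ KI ^ (α : ℝ) * edist x y ^ (α : ℝ) := by
    have h1 : edist z₁ z₂ ≤ KI * edist x y := by
      refine ((S.symm : E →L[ℝ] E).lipschitz.edist_le_mul x y).trans ?_
      gcongr
      have e1 : ((‖(S.symm : E →L[ℝ] E)‖₊ : ℝ≥0∞)) = ENNReal.ofReal ‖(S.symm : E →L[ℝ] E)‖ := by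
        rw [← coe_nnnorm, ENNReal.ofReal_coe_nnreal]
      rw [e1, hKI]
      exact ENNReal.ofReal_le_ofReal hSin
    calc edist z₁ z₂ ^ (α : ℝ) ≤ (KI * edist x y) ^ (α : ℝ) := ENNReal.rpow_le_rpow h1 hα0'
      _ = KI ^ (α : ℝ) * edist x y ^ (α : ℝ) := ENNReal.mul_rpow_of_nonneg _ _ hα0'
  have hKLb : ENNReal.ofReal M₀ + (CL * ‖S'‖₊ ^ (α : ℝ) : ℝ≥0) ≤ KL * (ENNReal.ofReal M₀ + CL) := by
    have hs : ‖S'‖₊ ^ (α : ℝ) ≤ sL := by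
      rw [hsL]
      refine NNReal.rpow_le_rpow ?_ hα0'
      rw [← NNReal.coe_le_coe, coe_nnnorm, Real.coe_toNNReal _ (Real.sqrt_nonneg _)]
      exact hSn
    rw [mul_add, ENNReal.coe_mul]
    refine add_le_add ?_ ?_
    · calc ENNReal.ofReal M₀ = 1 * ENNReal.ofReal M₀ := (one_mul _).symm
        _ ≤ KL * ENNReal.ofReal M₀ := by gcongr; exact le_self_add
    · rw [mul_comm (CL : ℝ≥0∞)]
      gcongr
      calc ((‖S'‖₊ ^ (α : ℝ) : ℝ≥0) : ℝ≥0∞) ≤ sL := by exact_mod_cast hs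
        _ ≤ KL := le_add_self
  calc edist (iteratedFDeriv ℝ 2 u x ![bE p, bE q]) (iteratedFDeriv ℝ 2 u y ![bE p, bE q])
      = edist (∑ ij ∈ (Finset.univ : Finset (ι × ι)), c ij • iteratedFDeriv ℝ 2 v z₁ ![bE ij.1, bE ij.2])
          (∑ ij ∈ (Finset.univ : Finset (ι × ι)), c ij • iteratedFDeriv ℝ 2 v z₂ ![bE ij.1, bE ij.2]) := by
        rw [hexp x, hexp y]
    _ ≤ ∑ ij ∈ (Finset.univ : Finset (ι × ι)), ‖c ij‖ₑ *
          edist (iteratedFDeriv ℝ 2 v z₁ ![bE ij.1, bE ij.2]) (iteratedFDeriv ℝ 2 v z₂ ![bE ij.1, bE ij.2]) :=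
        edist_sum_sum_smul_le _ _ _ _
    _ ≤ ∑ ij ∈ (Finset.univ : Finset (ι × ι)), (KI * KI) *
          (Cpq ij.1 ij.2 * (KL * (ENNReal.ofReal M₀ + CL)) * (KI ^ (α : ℝ) * edist x y ^ (α : ℝ))) := by
        refine Finset.sum_le_sum fun ij _ => ?_
        refine mul_le_mul' (hcoef ij) ?_
        refine (hmain ij.1 ij.2 z₁ z₂).trans ?_
        gcongr
    _ = (∑ ij ∈ (Finset.univ : Finset (ι × ι)), Cpq ij.1 ij.2) *
          (KI * KI * (KL * (ENNReal.ofReal M₀ + CL)) * (KI ^ (α : ℝ) * edist x y ^ (α : ℝ))) := by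
        rw [Finset.sum_mul]
        exact Finset.sum_congr rfl fun ij _ => by ring
    _ = C * (ENNReal.ofReal M₀ + CL) * edist x y ^ (α : ℝ) := by
        rw [Fintype.sum_prod_type, hC, hCsum]
        ring

end Literature.Analysis.FunctionSpaces

end
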